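import Summits.BirchSwinnertonDyer.BirchSwinnertonDyer.Theorems.GenusKolyvaginAtTwoPowDvdShaCardAtTwoRTNonPhantomAtMultiplicative
import Summits.BirchSwinnertonDyer.BirchSwinnertonDyer.Theorems.GenusKolyvaginAtTwoGenusPrimitiveSupplyAtTwoTwoAdicImageOverK
import Summits.BirchSwinnertonDyer.BirchSwinnertonDyer.Theorems.ByReductionTypeAtTwoRankOneAtTwoBigImageOddLocalOneDoorBottomLemma43AtTwo
import Literature.NumberTheory.EllipticCurves.SemistableReductionBaseChange
import Literature.NumberTheory.EllipticCurves.NeronComponentIndexSplitProofs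
import Literature.NumberTheory.EllipticCurves.NonsplitProofs
import HarnessLib

/-!
# Route `GenusKolyvaginAtTwo`, crux L_T `PowDvdShaCardAtTwoRT` (stmt-BirchSwinnertonDyer-23242), LINE 18 stub L, bottom rung:
# the NON-PHANTOM lemma (VI) — HABITAT FORM: on the route's habitat, the separation hypothesis `hres` of the pair Čebotarev
# over the Heegner field `K` is free at every odd multiplicative prime of `E/ℚ`

Seat `bsd-line-gk2-p3` g22 (PROVER 3/3, cell `bsd-f1-sign2`), `--supports stmt-BirchSwinnertonDyer-23242` (helper).
THEOREMS ONLY (no definition, no named fact, no `sorry`). BSD is not proved by any of this; neither is the crux.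

This file moves file (V)'s `hres_of_mem_selmerLocalKer` (stated for an elliptic curve over a number field and one of its
places) to the route's frame: `E/ℚ` with ODD TAMAGAWA PRODUCT and `ρ_{E,2^∞}` onto, `K` imaginary quadratic with `d_K` odd,
`K ≠ ℚ(√−|Δ|), ℚ(√−2|Δ|)`, and a prime `w` of `K` over an odd prime `v` of MULTIPLICATIVE reduction of `E` with `e(w|v) = 1`
(automatic under the Heegner hypothesis, tree
`ramificationIdx_eq_one_and_inertiaDeg_eq_one_of_natCast_mem_of_satisfiesHeegnerHypothesis`):

* `odd_ordMinimalDiscriminant_of_odd_tamagawaProduct` — **odd Tamagawa product ⟹ `ord_v Δ_min` odd at every multiplicative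
  `v`** (Kodaira–Néron: `c_v = ord_v Δ` if split, `c_v ∈ {1, 2}` with `2 ⟺ ord_v Δ` even if non-split; `c_v ∣ ∏ c`);
* `hres_baseChange_of_hasMultiplicativeReductionAt` — for `c, y ∈ H¹(K, E[4])` satisfying the local Kummer condition at `w`:
  `∀ a b, (∀ ρ ∈ Γ_{K(E[4])}, [a • c + b • y, ρ] = 0) → a • c + b • y = 0`, VERBATIM the `hres` of
  `PlusDescent.infinite_kolyvaginPrime_localization_fullOrder_pair` at `M = 2` for `W := W.baseChange K`.

For the LEAD's `false_of_bottomRung_engine(_cheb)`: `c = c₂(n) = d.kolyvaginClass 2 2` is in `selmerLocalKer` at `w ∤ n` by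
`RankOneAtTwoOneDoor.kolyvaginClass_two_mem_selmerLocalKer_of_odd_tamagawaProduct` (Gross 6.2 (1) / McCallum 4.3 on the
odd-Tamagawa habitat), and `res_K y` for `y ∈ H¹_{𝓛,⊤ on s∪t}(ℚ, E[4])` is Kummer at `w` because `v ∉ s ∪ t` (Kolyvagin primes
are good).  So finding (B) of memo `Cruxes/PowDvdShaCardAtTwoRT/Lines/plus-descent-lead-g16.md` §11 (the LW phantom, both
«`2c₂(n) ≠ φ₄|_K`» and the case `k = 1`) is CLOSED on the sub-habitat «some odd prime `p ∥ N`».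

References: [LawsonWuthrich2016] §7.1, §8; [SilvermanATAEC1994] IV.9.2 (d), IV.9.4 step 2; [SilvermanAEC2009] VII.5.4, VII.6.1;
[GrossLMS1991] §1, Prop. 9.1; [McCallumLMS1991] §3 Cor. 3.2.
-/

-- `Summit.<P>.<Sub>` repeats `BirchSwinnertonDyer` by the tree's layout convention (D-0017)
set_option linter.dupNamespace false
set_option autoImplicit false

noncomputable section

open scoped Classical
open NumberField IsDedekindDomain Field

namespace Summit.BirchSwinnertonDyer.BirchSwinnertonDyer.Theorems.GenusExact.NonPhantom

open WeierstrassCurve Literature.NumberTheory.EllipticCurves Literature.NumberTheory.GaloisRepresentations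
  Summit.BirchSwinnertonDyer.BirchSwinnertonDyer.Theorems.GenusKolyTwoAdicK
  Summit.BirchSwinnertonDyer.BirchSwinnertonDyer.Theorems.RankOneAtTwoOneDoor

/-- **Odd Tamagawa product ⟹ `ord_v Δ_min` odd at every multiplicative place** of `E/ℚ`: the local Tamagawa number `c_v`
divides `∏ c`, hence is odd; Kodaira–Néron gives `c_v = ord_v Δ_min` in the split case and `c_v = 2` for even `ord_v Δ_min`
in the non-split case. [cite: SilvermanATAEC1994, Cor. IV.9.2 (d) and IV.9.4 Step 2 (PDF pp. 340, 344)] -/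
theorem odd_ordMinimalDiscriminant_of_odd_tamagawaProduct (W : WeierstrassCurve ℚ) [W.IsElliptic]
    (hT : Odd W.tamagawaProduct) {v : HeightOneSpectrum (𝓞 ℚ)} (hmult : W.HasMultiplicativeReductionAt v) :
    Odd (W.ordMinimalDiscriminant v) := by
  haveI : Finite (IsLocalRing.ResidueField (v.adicCompletionIntegers ℚ)) :=
    HeightOneSpectrum.finite_residueField_adicCompletionIntegers ℚ v
  have hc : Odd ((W.baseChange (v.adicCompletion ℚ)).localTamagawaNumber (v.adicCompletionIntegers ℚ)) :=
    hT.of_dvd_nat (localTamagawaNumber_dvd_tamagawaProduct W v)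
  by_cases hs : W.HasSplitMultiplicativeReductionAt v
  · rwa [localTamagawaNumber_eq_ordMinimalDiscriminant_of_hasSplitMultiplicativeReductionAt v W hs] at hc
  · have h := localTamagawaNumber_of_hasNonsplitMultiplicativeReductionAt_holds v W hmult hs
    by_contra hodd
    rw [if_pos (Nat.not_odd_iff_even.mp hodd)] at h
    rw [h] at hc
    exact (Nat.not_even_iff_odd.mpr hc) even_two

/-- **THE NON-PHANTOM LEMMA ON THE HABITAT** (finding (B) of the LEAD's bottom-rung engine, closed on the sub-habitat «some
odd multiplicative prime»).  `E/ℚ` elliptic with odd Tamagawa product and `ρ_{E,2ⁿ}` onto for all `n ≥ 1`; `K` imaginary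
quadratic with `d_K` odd and `d_K·(−|Δ|)`, `d_K·(−2|Δ|)` non-squares (the Q5R frame, so that `Gal(K(E[4])/K) = GL₂(ℤ/4)`);
`v ∤ 2` a place of ℚ of MULTIPLICATIVE reduction, `w ∣ v` a place of `K` with `e(w|v) = 1`.  Then for all `c, y ∈ H¹(K, E[4])`
(`E` base-changed to `K`) satisfying the local Kummer condition at `w`, no non-zero `a • c + b • y` dies on `Γ_{K(E[4])}` —
the separation hypothesis `hres` of the full-order pair Čebotarev at `M = 2`.  Proof: file (V) at `w`, fed by
`odd_ordMinimalDiscriminant_of_odd_tamagawaProduct`, Silverman VII.5.4 (b) (`ord_w = e·ord_v`, multiplicative reduction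
ascends) and the tree's `hasSurjectiveModNGaloisRep_baseChange_two_pow`.
[cite: LawsonWuthrich2016, §7.1 and §8] [cite: SilvermanAEC2009, VII.5 Prop. 5.4 (b)] [cite: McCallumLMS1991, §3 Cor. 3.2] -/
theorem hres_baseChange_of_hasMultiplicativeReductionAt (W : WeierstrassCurve ℚ) [W.IsElliptic]
    (hT : Odd W.tamagawaProduct) (hρ : ∀ n : ℕ, 0 < n → W.HasSurjectiveModNGaloisRep ((2 : ℤ) ^ n))
    {K : Type} [Field K] [NumberField K] (hK : IsImaginaryQuadratic K) (hdK : Odd (NumberField.discr K))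
    (hns₁ : ¬ IsSquare ((NumberField.discr K : ℚ) * -|W.Δ|))
    (hns₂ : ¬ IsSquare ((NumberField.discr K : ℚ) * (-(2 * |W.Δ|))))
    {v : HeightOneSpectrum (𝓞 ℚ)} (h2v : ((2 : ℕ) : 𝓞 ℚ) ∉ v.asIdeal) (hmult : W.HasMultiplicativeReductionAt v)
    (w : HeightOneSpectrum (𝓞 K)) [w.asIdeal.LiesOver v.asIdeal] (he : w.asIdeal.ramificationIdx (𝓞 ℚ) = 1)
    {n : ℤ} (hn : n = 4) {c y : galH1Torsion (W.baseChange K) n}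
    (hc : c ∈ selmerLocalKer (W.baseChange K) (w.adicCompletion K) n)
    (hy : y ∈ selmerLocalKer (W.baseChange K) (w.adicCompletion K) n) :
    ∀ a b : ℤ, (∀ ρ ∈ torsionFixing (W.baseChange K) n, h1Eval (W.baseChange K) n (a • c + b • y) ρ = 0) →
      a • c + b • y = 0 := by
  haveI : (W.baseChange K).IsElliptic := inferInstanceAs ((W.map (algebraMap ℚ K)).IsElliptic)
  -- multiplicative reduction and `ord Δ` ascend to `w` (Silverman VII.5.4 (b); `e(w|v) = 1`)
  have hmultK : (W.baseChange K).HasMultiplicativeReductionAt w :=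
    hasMultiplicativeReductionAt_baseChange_of_liesOver (L := K) (v := v) (w := w) W hmult
  have hordK : (W.baseChange K).ordMinimalDiscriminant w = W.ordMinimalDiscriminant v := by
    rw [ordMinimalDiscriminant_baseChange_of_isSemistableAt (L := K) (v := v) (w := w) W (Or.inr hmult),
      Ideal.ramificationIdx'_eq_ramificationIdx v.asIdeal w.asIdeal v.ne_bot, he, one_mul]
  have hodd : Odd ((W.baseChange K).ordMinimalDiscriminant w) := by
    rw [hordK]; exact odd_ordMinimalDiscriminant_of_odd_tamagawaProduct W hT hmult
  -- `w ∤ 2`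
  have h2w : ((2 : ℕ) : 𝓞 K) ∉ w.asIdeal := by
    intro h
    apply h2v
    rw [Ideal.LiesOver.over (P := w.asIdeal) (p := v.asIdeal), Ideal.under_def, Ideal.mem_comap, map_natCast]
    exact h
  -- `Gal(K(E[4])/K) = GL₂(ℤ/4)`
  have hρK : (W.baseChange K).HasSurjectiveModNGaloisRep n := by
    have h := hasSurjectiveModNGaloisRep_baseChange_two_pow W hK hdK hns₁ hns₂ hρ 2 two_pos
    rw [hn]
    norm_num at h
    exact h
  exact hres_of_mem_selmerLocalKer (W.baseChange K) hmultK h2w hodd hn hρK hc hy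

end Summit.BirchSwinnertonDyer.BirchSwinnertonDyer.Theorems.GenusExact.NonPhantom

end
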